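import Literature.Analysis.FluidPDE.PineauVicolRSSHolds
import Literature.Analysis.FluidPDE.AxisymmetricReflection
import Literature.Analysis.FluidPDE.IsometryInvariance
import HarnessLib

/-!
# Route TypeICertificateLadder — crux `Target` (item stmt-NavierStokesRegularity-1217),
# line `killing-twisted-bernoulli-solitons`: reflection symmetry of the RSS Liouville property

Helper file (theorems only) for the compactness step of the window-Liouville programme
(stub `rssCompact_liouvilleAt_neg`). For a Type-I constant `C₀` and a rotation speed `α`, the
Pineau–Vicol RSS Liouville property `L(C₀, α)` says: every classical Navier–Stokes solution on
`[−1, 0)` with the Type-I bound `‖u(t, x)‖ ≤ C₀ / (‖x‖ + √(−t))` (arXiv:2607.09619, (1.10)) that is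
the rotated self-similar ansatz `pvAnsatz α U` ((1.7)) of a `C²` profile `U` has `U = 0`
(Theorem 1.4 / Conjecture 1.1 of the source). This file proves the elementary symmetry
`L(C₀, α) → L(C₀, −α)`: conjugating by the meridian reflection `σ = reflY`,
`σ (x₀, x₁, x₂) = (x₀, −x₁, x₂)`, reverses the sense of the rotations about the axis,
`σ R(θ) = R(−θ) σ` (`rssCompact_reflY_rotZ`), so that `u' (t, x) = σ (u (t, σ x))` is again a
classical solution (isometry covariance, `IsClassicalNSSolutionOn.conj_linearIsometryEquiv`) with
the same Type-I constant, and is the ansatz with speed `+α` of the reflected profile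
`U' y = σ (U (σ y))`; hence `U' = 0` and `U = 0`.
-/

noncomputable section

-- the summit and its single sub-problem share the name (CONVENTIONS §1), as in every Theorems file
set_option linter.dupNamespace false

namespace Summit.NavierStokesRegularity.NavierStokesRegularity.Theorems

open Set Function
open Literature.Analysis.FluidPDE

/-- **The meridian reflection reverses the rotations about the axis**:
`σ (R_θ z) = R_{−θ} (σ z)`. [folklore] -/
private theorem rssCompact_reflY_rotZ (θ : ℝ) (z : EuclideanSpace ℝ (Fin 3)) :
    reflY (rotZ θ z) = rotZ (-θ) (reflY z) := by
  ext i
  fin_cases i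
  · simp [Real.cos_neg, Real.sin_neg]
  · simp [Real.cos_neg, Real.sin_neg]
    ring
  · simp

/-- **Reflection symmetry of the RSS Liouville property, `L(C₀, α) → L(C₀, −α)`.** If every
Type-I (constant `C₀`) classical solution on `[−1, 0)` which is the Pineau–Vicol rotated
self-similar ansatz with speed `α` of a `C²` profile has vanishing profile, then the same holds
with speed `−α`: given such a solution `(u, p)` with speed `−α` and profile `U`, the reflected
pair `u' (t, x) = σ (u (t, σ x))`, `p' (t, x) = p (t, σ x)` (`σ = reflY`) is a classical
solution with the same Type-I bound and is the ansatz with speed `α` of the `C²` profile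
`U' y = σ (U (σ y))` (`σ R(θ) = R(−θ) σ`), so `U' = 0`, whence `U = 0`. [folklore] -/
theorem rssCompact_liouvilleAt_neg :
    ∀ (C₀ α : ℝ),
    (∀ (u : ℝ → EuclideanSpace ℝ (Fin 3) → EuclideanSpace ℝ (Fin 3))
        (p : ℝ → EuclideanSpace ℝ (Fin 3) → ℝ) (U : EuclideanSpace ℝ (Fin 3) → EuclideanSpace ℝ (Fin 3)),
      Literature.Analysis.FluidPDE.IsClassicalNSSolutionOn (Set.Ico (-1) 0) 1 0 u p →
      (∀ t ∈ Set.Ico (-1 : ℝ) 0, ∀ x : EuclideanSpace ℝ (Fin 3), ‖u t x‖ ≤ C₀ / (‖x‖ + Real.sqrt (-t))) →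
      ContDiff ℝ 2 U →
      (∀ t ∈ Set.Ico (-1 : ℝ) 0, ∀ x : EuclideanSpace ℝ (Fin 3),
        u t x = Literature.Analysis.FluidPDE.pvAnsatz α (fun y _ => U y) t x) → U = 0) →
    (∀ (u : ℝ → EuclideanSpace ℝ (Fin 3) → EuclideanSpace ℝ (Fin 3))
        (p : ℝ → EuclideanSpace ℝ (Fin 3) → ℝ) (U : EuclideanSpace ℝ (Fin 3) → EuclideanSpace ℝ (Fin 3)),
      Literature.Analysis.FluidPDE.IsClassicalNSSolutionOn (Set.Ico (-1) 0) 1 0 u p →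
      (∀ t ∈ Set.Ico (-1 : ℝ) 0, ∀ x : EuclideanSpace ℝ (Fin 3), ‖u t x‖ ≤ C₀ / (‖x‖ + Real.sqrt (-t))) →
      ContDiff ℝ 2 U →
      (∀ t ∈ Set.Ico (-1 : ℝ) 0, ∀ x : EuclideanSpace ℝ (Fin 3),
        u t x = Literature.Analysis.FluidPDE.pvAnsatz (-α) (fun y _ => U y) t x) → U = 0) := by
  intro C₀ α hL u p U hsol hI hU hans
  -- (1) the reflected pair is a classical solution (isometry covariance; the force stays `0`)
  have hsol' : IsClassicalNSSolutionOn (Ico (-1) 0) 1 0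
      (fun t x => reflY (u t (reflY.symm x))) (fun t x => p t (reflY.symm x)) := by
    have h1 := hsol.conj_linearIsometryEquiv reflY (uniqueDiffOn_Ico (-1) 0)
    have hf : (fun t x => reflY ((0 : ℝ → EuclideanSpace ℝ (Fin 3) → EuclideanSpace ℝ (Fin 3)) t
        (reflY.symm x))) = (0 : ℝ → EuclideanSpace ℝ (Fin 3) → EuclideanSpace ℝ (Fin 3)) := by
      funext t x
      simp
    rwa [hf] at h1
  -- (2) the Type-I bound with the same constant
  have hI' : ∀ t ∈ Ico (-1 : ℝ) 0, ∀ x : EuclideanSpace ℝ (Fin 3),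
      ‖reflY (u t (reflY.symm x))‖ ≤ C₀ / (‖x‖ + Real.sqrt (-t)) := by
    intro t ht x
    have h := hI t ht (reflY.symm x)
    rw [LinearIsometryEquiv.norm_map] at h
    rwa [LinearIsometryEquiv.norm_map]
  -- (3) the reflected profile is `C²`
  have hU' : ContDiff ℝ 2 (fun y => reflY (U (reflY.symm y))) :=
    reflY.contDiff.comp (hU.comp reflY.symm.contDiff)
  -- (4) the reflected field is the ansatz with speed `+α` of the reflected profile
  have hans' : ∀ t ∈ Ico (-1 : ℝ) 0, ∀ x : EuclideanSpace ℝ (Fin 3),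
      reflY (u t (reflY.symm x)) =
        pvAnsatz α (fun y _ => reflY (U (reflY.symm y))) t x := by
    intro t ht x
    rw [hans t ht (reflY.symm x)]
    simp only [pvAnsatz, reflY_symm, LinearIsometryEquiv.map_smul, rssCompact_reflY_rotZ,
      neg_mul, neg_neg]
  -- (5) apply `L(C₀, α)` to the reflected data and undo the reflection
  have hzero := hL _ _ _ hsol' hI' hU' hans'
  funext y
  have hy := congr_fun hzero (reflY y)
  simp only [reflY_symm, reflY_reflY, Pi.zero_apply] at hy
  rw [Pi.zero_apply]
  exact reflY.injective (by rw [hy, map_zero])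

/-- Signature probe: the statement registered for the stub. -/
example :
    ∀ (C₀ α : ℝ),
    (∀ (u : ℝ → EuclideanSpace ℝ (Fin 3) → EuclideanSpace ℝ (Fin 3))
        (p : ℝ → EuclideanSpace ℝ (Fin 3) → ℝ) (U : EuclideanSpace ℝ (Fin 3) → EuclideanSpace ℝ (Fin 3)),
      Literature.Analysis.FluidPDE.IsClassicalNSSolutionOn (Set.Ico (-1) 0) 1 0 u p →
      (∀ t ∈ Set.Ico (-1 : ℝ) 0, ∀ x : EuclideanSpace ℝ (Fin 3), ‖u t x‖ ≤ C₀ / (‖x‖ + Real.sqrt (-t))) →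
      ContDiff ℝ 2 U →
      (∀ t ∈ Set.Ico (-1 : ℝ) 0, ∀ x : EuclideanSpace ℝ (Fin 3),
        u t x = Literature.Analysis.FluidPDE.pvAnsatz α (fun y _ => U y) t x) → U = 0) →
    (∀ (u : ℝ → EuclideanSpace ℝ (Fin 3) → EuclideanSpace ℝ (Fin 3))
        (p : ℝ → EuclideanSpace ℝ (Fin 3) → ℝ) (U : EuclideanSpace ℝ (Fin 3) → EuclideanSpace ℝ (Fin 3)),
      Literature.Analysis.FluidPDE.IsClassicalNSSolutionOn (Set.Ico (-1) 0) 1 0 u p →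
      (∀ t ∈ Set.Ico (-1 : ℝ) 0, ∀ x : EuclideanSpace ℝ (Fin 3), ‖u t x‖ ≤ C₀ / (‖x‖ + Real.sqrt (-t))) →
      ContDiff ℝ 2 U →
      (∀ t ∈ Set.Ico (-1 : ℝ) 0, ∀ x : EuclideanSpace ℝ (Fin 3),
        u t x = Literature.Analysis.FluidPDE.pvAnsatz (-α) (fun y _ => U y) t x) → U = 0) :=
  rssCompact_liouvilleAt_neg

end Summit.NavierStokesRegularity.NavierStokesRegularity.Theorems

end
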